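import Summits.CriticalPhenomena.PercolationContinuityZ3.Theorems.PercNearOneGluingNoHeavyLowerTailSahiCombTensorisation

/-!
# `NoHeavyLowerTail` (crux stmt-CriticalPhenomena-4575), Sahi / Kahn positivity with ONE HITTING SLOT — preliminaries

Support file (cell `prim-l12`, seat P3 = Ahlswede–Daykin / four functions, gen 3; `--supports stmt-CriticalPhenomena-4575`).
No `sorry`, no named facts, standard axioms.  New mathematics (the theorem it prepares is not in print); tools are folklore.

TARGET (proved in the companion files `…SahiHittingSlotLocal`, `…SahiHittingSlot`): for every finite cube `2^ι`, every product
measure `μ_p`, every finite `A ⊆ ι` and ALL increasing events `U, V`,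
`E₃(1_{H_A}, 1_U, 1_V) ≥ 0`, `H_A = {ω | ω ∩ A ≠ ∅}` the HITTING event of `A` (Kahn's Conjecture 5 / Sahi's `C₃` for the triple
(hitting, arbitrary, arbitrary); the case dual to the cylinder slot; open target of `…SahiE3HittingEvents`).

This file: the local toolkit on the cube, all under the product weight `bernoulliWeight p` and in the tree's vocabulary `ex`, `ind`:
* `pr p X` = `μ_p(X)`; `hit A`, `noneOpen A = {ω | ω ∩ A = ∅}`, `dlt A p = Π_{a∈A}(1 − p_a) = μ_p(noneOpen A)` (`pr_noneOpen`, `pr_hit`),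
  the one-atom probabilities `pr_exactly` (`μ_p{ω ∩ A = {a}} = p_a Π_{b ∈ A∖a}(1 − p_b)`);
* events determined by `A` (tree predicate `DeterminedBy X ↑A`): `pr_hit_inter` etc.;
* CONDITIONING ON A CLOSED BLOCK (`sum_noneOpen_mul`): `E_p[1_{ω∩I=∅}·F] = dlt I p · E_p[F(· ∖ I)]` (from `BHK2006.blockFubini`);
* THE COVARIANCE LEMMA (`cov_ge_of_not_mem`): for increasing `A`-determined `X, Z` not containing `∅`,
  `μ(X ∩ Z) − μ(X)μ(Z) ≥ dlt A p · (1 − Π_{a ∈ I}(1 − p_a))`, `I` = the singletons `{a}` lying in both `X` and `Z`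
  (condition on `I` closed; Harris for the two decreasing complements; `noneOpen A ⊆ Xᶜ ∩ Zᶜ`);
The first-open weights, the certificate weight and the two-configuration lemma are in `…SahiHittingSlotWeights` /
`…SahiHittingSlot`.
-/

noncomputable section

open scoped Classical

namespace Summit.CriticalPhenomena.PercolationContinuityZ3.Theorems

namespace SahiHittingSlot

open Finset
open Literature.Combinatorics.Sahi2008
open Literature.Probability.Percolation (DeterminedBy determinedBy_iff)
open SahiCombTensor (sum_bernoulliWeight_inter_eq)
open Literature.Probability.Percolation.BHK2006 (weight weight_nonneg harris harris_anti_anti blockFubini ind_inter ind_mono ind_le_one)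
open Literature.Probability.Percolation.DecisionTree (ind ind_of_mem ind_of_not_mem ind_nonneg)

variable {ι : Type} [Fintype ι]

/-! ### Probabilities under the product weight -/

/-- `μ_p(X)`: the probability of the event `X ⊆ 2^ι` under the product weight. [folklore] -/
def pr (p : ι → unitInterval) (X : Set (Set ι)) : ℝ := ex (bernoulliWeight p) (ind X)

/-- Unfolding `pr` as a weighted sum of the indicator. [folklore] -/
theorem pr_eq_sum (p : ι → unitInterval) (X : Set (Set ι)) : pr p X = ∑ ω, bernoulliWeight p ω * ind X ω := rfl

omit [Fintype ι] in
/-- The coordinates' parameters lie in `[0,1]` (lower bound). [folklore] -/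
theorem p_nonneg (p : ι → unitInterval) (e : ι) : 0 ≤ (p e : ℝ) := (p e).2.1

omit [Fintype ι] in
/-- The coordinates' parameters lie in `[0,1]` (upper bound). [folklore] -/
theorem p_le_one (p : ι → unitInterval) (e : ι) : (p e : ℝ) ≤ 1 := (p e).2.2

/-- The product weight is nonnegative. [folklore] -/
theorem bw_nonneg (p : ι → unitInterval) (ω : Set ι) : 0 ≤ bernoulliWeight p ω :=
  weight_nonneg (p_nonneg p) (p_le_one p) ω

/-- `μ_p(X) ≥ 0`. [folklore] -/
theorem pr_nonneg (p : ι → unitInterval) (X : Set (Set ι)) : 0 ≤ pr p X :=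
  ex_nonneg (bw_nonneg p) (ind_nonneg X)

/-- `μ_p` is monotone. [folklore] -/
theorem pr_mono (p : ι → unitInterval) {X Y : Set (Set ι)} (h : X ⊆ Y) : pr p X ≤ pr p Y :=
  ex_mono (bw_nonneg p) (ind_mono h)

/-- `μ_p(univ) = 1`. [folklore] -/
theorem pr_univ (p : ι → unitInterval) : pr p Set.univ = 1 := by
  rw [pr, ind_univ_eq_one]; exact ex_one (sum_bernoulliWeight p)

/-- `μ_p(X) ≤ 1`. [folklore] -/
theorem pr_le_one (p : ι → unitInterval) (X : Set (Set ι)) : pr p X ≤ 1 :=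
  (pr_mono p (Set.subset_univ X)).trans (pr_univ p).le

/-- `μ_p(Xᶜ) = 1 − μ_p(X)`. [folklore] -/
theorem pr_compl (p : ι → unitInterval) (X : Set (Set ι)) : pr p Xᶜ = 1 - pr p X := by
  rw [← pr_univ p, pr_eq_sum, pr_eq_sum, pr_eq_sum, ← sum_sub_distrib]
  refine sum_congr rfl fun ω _ => ?_
  by_cases h : ω ∈ X
  · rw [ind_of_not_mem (show ω ∉ Xᶜ from fun h' => h' h), ind_of_mem (Set.mem_univ ω), ind_of_mem h]; ring
  · rw [ind_of_mem (show ω ∈ Xᶜ from h), ind_of_mem (Set.mem_univ ω), ind_of_not_mem h]; ring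

/-- Inclusion–exclusion: `μ(X ∪ Y) = μ(X) + μ(Y) − μ(X ∩ Y)`. [folklore] -/
theorem pr_union (p : ι → unitInterval) (X Y : Set (Set ι)) : pr p (X ∪ Y) = pr p X + pr p Y - pr p (X ∩ Y) := by
  simp only [pr_eq_sum, ← sum_add_distrib, ← sum_sub_distrib]
  refine sum_congr rfl fun ω _ => ?_
  by_cases hX : ω ∈ X <;> by_cases hY : ω ∈ Y <;>
    simp [ind_of_mem, ind_of_not_mem, hX, hY, Set.mem_union, Set.mem_inter_iff]

/-- `μ(Xᶜ ∩ Yᶜ) = 1 − μ(X) − μ(Y) + μ(X ∩ Y)`. [folklore] -/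
theorem pr_compl_inter_compl (p : ι → unitInterval) (X Y : Set (Set ι)) :
    pr p (Xᶜ ∩ Yᶜ) = 1 - pr p X - pr p Y + pr p (X ∩ Y) := by
  rw [← Set.compl_union, pr_compl, pr_union]; ring

omit [Fintype ι] in
/-- Comparing indicators at two points: `1_Y(b) ≤ 1_X(a)` when `b ∈ Y → a ∈ X`. [folklore] -/
theorem ind_le_ind_of_imp {α : Type*} {X Y : Set α} {a b : α} (h : b ∈ Y → a ∈ X) : ind Y b ≤ ind X a := by
  by_cases hb : b ∈ Y
  · rw [ind_of_mem hb, ind_of_mem (h hb)]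
  · rw [ind_of_not_mem hb]; exact ind_nonneg X a

/-! ### Hitting events, the all-closed event, atom probabilities -/

/-- The HITTING event of `A`: some coordinate of `A` is open (`H_A = {ω | ω ∩ A ≠ ∅}`, written as in `…SahiE3HittingEvents`). [folklore] -/
def hit (A : Finset ι) : Set (Set ι) := {ω | ∃ a ∈ A, a ∈ ω}

/-- The event "every coordinate of `A` is closed" (the decreasing cylinder dual to `hit A`). [folklore] -/
def noneOpen (A : Finset ι) : Set (Set ι) := {ω | ω ∩ ↑A = ∅}

/-- `dlt A p = Π_{a∈A} (1 − p_a)`, the probability that `A` is entirely closed. [folklore] -/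
def dlt (A : Finset ι) (p : ι → unitInterval) : ℝ := ∏ a ∈ A, (1 - (p a : ℝ))

omit [Fintype ι] in
/-- Membership in `noneOpen`. [folklore] -/
theorem mem_noneOpen {A : Finset ι} {ω : Set ι} : ω ∈ noneOpen A ↔ ω ∩ ↑A = ∅ := Iff.rfl

omit [Fintype ι] in
/-- `hit A` is the complement of `noneOpen A`. [folklore] -/
theorem hit_eq_compl (A : Finset ι) : hit A = (noneOpen A)ᶜ := by
  ext ω
  simp only [hit, Set.mem_setOf_eq, Set.mem_compl_iff, mem_noneOpen, Set.eq_empty_iff_forall_notMem, Set.mem_inter_iff,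
    mem_coe, not_forall, not_not]
  constructor
  · rintro ⟨a, ha, haω⟩; exact ⟨a, haω, ha⟩
  · rintro ⟨a, haω, ha⟩; exact ⟨a, ha, haω⟩

omit [Fintype ι] in
/-- `hit A` is increasing. [folklore] -/
theorem isUpperSet_hit (A : Finset ι) : IsUpperSet (hit A) := by
  rintro ω ω' hle ⟨a, ha, haω⟩; exact ⟨a, ha, hle haω⟩

omit [Fintype ι] in
/-- `0 ≤ dlt`. [folklore] -/
theorem dlt_nonneg (A : Finset ι) (p : ι → unitInterval) : 0 ≤ dlt A p :=
  prod_nonneg fun a _ => sub_nonneg.2 (p_le_one p a)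

omit [Fintype ι] in
/-- `dlt ≤ 1`. [folklore] -/
theorem dlt_le_one (A : Finset ι) (p : ι → unitInterval) : dlt A p ≤ 1 :=
  prod_le_one (fun a _ => sub_nonneg.2 (p_le_one p a)) fun a _ => sub_le_self _ (p_nonneg p a)

/-- A cylinder probability: `μ_p{α | α ∩ A = ω ∩ A} = Π_{e∈A} (p_e if e ∈ ω else 1 − p_e)` (the tree's `sum_bernoulliWeight_inter_eq`). [folklore] -/
theorem pr_cylinder (p : ι → unitInterval) (A : Finset ι) (ω : Set ι) :
    pr p {α | α ∩ ↑A = ω ∩ ↑A} = ∏ e ∈ A, (if e ∈ ω then (p e : ℝ) else 1 - (p e : ℝ)) := by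
  refine Eq.trans ?_ (sum_bernoulliWeight_inter_eq p A ω)
  rw [pr_eq_sum]
  refine sum_congr rfl fun α _ => ?_
  by_cases h : α ∩ ↑A = ω ∩ ↑A
  · rw [if_pos h, ind_of_mem (show α ∈ {α : Set ι | α ∩ ↑A = ω ∩ ↑A} from h), mul_one]
  · rw [if_neg h, ind_of_not_mem (show α ∉ {α : Set ι | α ∩ ↑A = ω ∩ ↑A} from h), mul_zero]

/-- `μ_p(noneOpen A) = dlt A p`. [folklore] -/
theorem pr_noneOpen (p : ι → unitInterval) (A : Finset ι) : pr p (noneOpen A) = dlt A p := by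
  have h := pr_cylinder p A ∅
  simp only [Set.empty_inter, Set.mem_empty_iff_false, if_false] at h
  exact h

/-- `μ_p(hit A) = 1 − dlt A p`. [folklore] -/
theorem pr_hit (p : ι → unitInterval) (A : Finset ι) : pr p (hit A) = 1 - dlt A p := by
  rw [hit_eq_compl, pr_compl, pr_noneOpen]

/-- The event "exactly the coordinate `a` of `A` is open". [folklore] -/
def exactly (A : Finset ι) (a : ι) : Set (Set ι) := {ω | ω ∩ ↑A = {a}}

omit [Fintype ι] in
/-- Membership in `exactly`. [folklore] -/
theorem mem_exactly {A : Finset ι} {a : ι} {ω : Set ι} : ω ∈ exactly A a ↔ ω ∩ ↑A = {a} := Iff.rfl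

/-- `μ_p{ω ∩ A = {a}} = p_a · Π_{b ∈ A ∖ a}(1 − p_b)` for `a ∈ A`. [folklore] -/
theorem pr_exactly (p : ι → unitInterval) {A : Finset ι} {a : ι} (ha : a ∈ A) :
    pr p (exactly A a) = (p a : ℝ) * ∏ b ∈ A.erase a, (1 - (p b : ℝ)) := by
  have hset : exactly A a = {α : Set ι | α ∩ ↑A = ({a} : Set ι) ∩ ↑A} := by
    have : ({a} : Set ι) ∩ ↑A = {a} := Set.inter_eq_left.2 (Set.singleton_subset_iff.2 (mem_coe.2 ha))
    rw [this]; rfl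
  rw [hset, pr_cylinder, ← mul_prod_erase A _ ha]
  simp only [Set.mem_singleton_iff, if_true]
  congr 1
  exact prod_congr rfl fun b hb => by rw [if_neg (ne_of_mem_erase hb)]

/-! ### Events determined by `A` (tree predicate `DeterminedBy X ↑A`) -/

omit [Fintype ι] in
/-- Two configurations with the same `A`-part agree on an `A`-determined event. [folklore] -/
theorem mem_iff_of_inter_eq {A : Finset ι} {X : Set (Set ι)} (hX : DeterminedBy X (↑A : Set ι)) {ω ω' : Set ι}
    (h : ω ∩ ↑A = ω' ∩ ↑A) : ω ∈ X ↔ ω' ∈ X :=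
  (determinedBy_iff X ↑A).1 hX ω ω' h

omit [Fintype ι] in
/-- Intersections of `A`-determined events are `A`-determined. [folklore] -/
theorem determinedBy_inter {A : Finset ι} {X Y : Set (Set ι)} (hX : DeterminedBy X (↑A : Set ι))
    (hY : DeterminedBy Y (↑A : Set ι)) : DeterminedBy (X ∩ Y) (↑A : Set ι) :=
  (determinedBy_iff _ _).2 fun ω ω' h => by
    rw [Set.mem_inter_iff, Set.mem_inter_iff, mem_iff_of_inter_eq hX h, mem_iff_of_inter_eq hY h]

omit [Fintype ι] in
/-- `hit A` is `A`-determined. [folklore] -/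
theorem determinedBy_hit (A : Finset ι) : DeterminedBy (hit A) (↑A : Set ι) := by
  refine (determinedBy_iff _ _).2 fun ω ω' h => ?_
  simp only [hit, Set.mem_setOf_eq]
  constructor
  · rintro ⟨a, ha, haω⟩
    have : a ∈ ω' ∩ ↑A := by rw [← h]; exact ⟨haω, mem_coe.2 ha⟩
    exact ⟨a, ha, this.1⟩
  · rintro ⟨a, ha, haω⟩
    have : a ∈ ω ∩ ↑A := by rw [h]; exact ⟨haω, mem_coe.2 ha⟩
    exact ⟨a, ha, this.1⟩

omit [Fintype ι] in
/-- An increasing event containing `∅` is everything. [folklore] -/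
theorem eq_univ_of_empty_mem {X : Set (Set ι)} (hU : IsUpperSet X) (h : (∅ : Set ι) ∈ X) : X = Set.univ :=
  Set.eq_univ_of_forall fun ω => hU (Set.empty_subset ω) h

omit [Fintype ι] in
/-- An `A`-determined event not containing `∅` lies inside `hit A`. [folklore] -/
theorem subset_hit_of_empty_notMem {A : Finset ι} {X : Set (Set ι)} (hX : DeterminedBy X (↑A : Set ι))
    (h : (∅ : Set ι) ∉ X) : X ⊆ hit A := by
  intro ω hω
  rw [hit_eq_compl, Set.mem_compl_iff, mem_noneOpen]
  intro h0
  exact h ((mem_iff_of_inter_eq hX (by rw [h0, Set.empty_inter])).1 hω)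

omit [Fintype ι] in
/-- `noneOpen A` misses every `A`-determined event not containing `∅`. [folklore] -/
theorem noneOpen_subset_compl {A : Finset ι} {X : Set (Set ι)} (hX : DeterminedBy X (↑A : Set ι))
    (h : (∅ : Set ι) ∉ X) : noneOpen A ⊆ Xᶜ := by
  intro ω hω hωX
  exact h ((mem_iff_of_inter_eq hX (by rw [mem_noneOpen.1 hω, Set.empty_inter])).1 hωX)

/-- `μ(hit A ∩ X) = μ(X) − dlt·1_X(∅)` for an increasing `A`-determined `X`. [folklore] -/
theorem pr_hit_inter {A : Finset ι} (p : ι → unitInterval) {X : Set (Set ι)} (hX : DeterminedBy X (↑A : Set ι))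
    (hU : IsUpperSet X) : pr p (hit A ∩ X) = pr p X - dlt A p * ind X ∅ := by
  by_cases h : (∅ : Set ι) ∈ X
  · rw [eq_univ_of_empty_mem hU h, Set.inter_univ, pr_hit, pr_univ, ind_of_mem (Set.mem_univ _), mul_one]
  · rw [Set.inter_eq_right.2 (subset_hit_of_empty_notMem hX h), ind_of_not_mem h, mul_zero, sub_zero]

/-! ### Conditioning on a closed block -/

/-- **Conditioning on "`I` closed"**: `E_p[1_{ω ∩ I = ∅} · F(ω)] = dlt I p · E_p[F(ω ∖ I)]`. [folklore] -/
theorem sum_noneOpen_mul (p : ι → unitInterval) (I : Finset ι) (F : Set ι → ℝ) :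
    ∑ ω, bernoulliWeight p ω * (ind (noneOpen I) ω * F ω) =
      dlt I p * ∑ ω, bernoulliWeight p ω * F (ω \ ↑I) := by
  have hone := sum_bernoulliWeight p
  -- pointwise: on `noneOpen I`, `F ω = F (ω \ I)`
  have hpt : ∀ ω : Set ι, ind (noneOpen I) ω * F ω =
      (fun x y : Set ι => ind ({∅} : Set (Set ι)) x * F y) (ω ∩ ↑I) (ω \ ↑I) := by
    intro ω
    by_cases h : ω ∩ ↑I = ∅
    · have hdiff : ω \ ↑I = ω := (Set.disjoint_iff_inter_eq_empty.2 h).sdiff_eq_left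
      simp only [ind_of_mem (mem_noneOpen.2 h), h, ind_of_mem (Set.mem_singleton _), hdiff]
    · simp only [ind_of_not_mem (show ω ∉ noneOpen I from h), ind_of_not_mem (show ω ∩ ↑I ∉ ({∅} : Set (Set ι)) from h),
        zero_mul]
  have hbf := blockFubini (fun e => (p e : ℝ)) (↑I : Set ι) (fun x y : Set ι => ind ({∅} : Set (Set ι)) x * F y)
  rw [show (∑ ω, weight (fun e => (p e : ℝ)) ω) = 1 from hone, one_mul] at hbf
  simp_rw [hpt]
  change ∑ ω, bernoulliWeight p ω * _ = _ at hbf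
  rw [hbf]
  have hinner : ∀ ω : Set ι, ∑ ω', weight (fun e => (p e : ℝ)) ω' * (ind ({∅} : Set (Set ι)) (ω ∩ ↑I) * F (ω' \ ↑I)) =
      ind (noneOpen I) ω * ∑ ω', bernoulliWeight p ω' * F (ω' \ ↑I) := by
    intro ω
    rw [mul_sum]
    refine sum_congr rfl fun ω' _ => ?_
    have : ind ({∅} : Set (Set ι)) (ω ∩ ↑I) = ind (noneOpen I) ω := by
      by_cases h : ω ∩ ↑I = ∅
      · rw [ind_of_mem (show ω ∩ ↑I ∈ ({∅} : Set (Set ι)) from h), ind_of_mem (mem_noneOpen.2 h)]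
      · rw [ind_of_not_mem (show ω ∩ ↑I ∉ ({∅} : Set (Set ι)) from h), ind_of_not_mem (show ω ∉ noneOpen I from h)]
    rw [this]; change _ = _ * (bernoulliWeight p ω' * _); ring
  simp_rw [hinner, ← mul_assoc]
  rw [← sum_mul, ← pr_eq_sum, pr_noneOpen]


/-! ### The covariance lemma -/

/-- **Covariance lemma.**  For increasing `A`-determined events `X, Z` not containing the all-closed configuration, with `I` the
set of coordinates `a ∈ A` whose singleton lies in both:  `μ(X ∩ Z) − μ(X)μ(Z) ≥ dlt A p · (1 − Π_{a∈I}(1 − p_a))`.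
Proof: the complements are decreasing and supported on `{ω ∩ I = ∅}`; condition on `I` closed (`sum_noneOpen_mul`), apply Harris to
the two decreasing conditional indicators, and use `noneOpen A ⊆ Xᶜ ∩ Zᶜ`. [this work] -/
theorem cov_ge_of_empty_notMem (A : Finset ι) (p : ι → unitInterval) {X Z : Set (Set ι)}
    (hXd : DeterminedBy X (↑A : Set ι)) (hZd : DeterminedBy Z (↑A : Set ι)) (hXu : IsUpperSet X) (hZu : IsUpperSet Z)
    (hX0 : (∅ : Set ι) ∉ X) (hZ0 : (∅ : Set ι) ∉ Z) :
    dlt A p * (1 - ∏ a ∈ A with ({a} : Set ι) ∈ X ∧ ({a} : Set ι) ∈ Z, (1 - (p a : ℝ))) ≤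
      pr p (X ∩ Z) - pr p X * pr p Z := by
  set I : Finset ι := A.filter fun a => ({a} : Set ι) ∈ X ∧ ({a} : Set ι) ∈ Z with hI
  -- complements are supported on `noneOpen I`
  have hsuppX : ∀ ω, ind Xᶜ ω = ind (noneOpen I) ω * ind Xᶜ ω := by
    intro ω
    by_cases hω : ω ∈ noneOpen I
    · rw [ind_of_mem hω, one_mul]
    · have : ω ∈ X := by
        rw [mem_noneOpen, ← Ne, ← Set.nonempty_iff_ne_empty] at hω
        obtain ⟨a, haω, haI⟩ := hω
        have haX : ({a} : Set ι) ∈ X := ((mem_filter.1 (mem_coe.1 haI)).2).1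
        exact hXu (Set.singleton_subset_iff.2 haω) haX
      rw [ind_of_not_mem (show ω ∉ Xᶜ from fun h => h this), mul_zero]
  have hsuppZ : ∀ ω, ind Zᶜ ω = ind (noneOpen I) ω * ind Zᶜ ω := by
    intro ω
    by_cases hω : ω ∈ noneOpen I
    · rw [ind_of_mem hω, one_mul]
    · have : ω ∈ Z := by
        rw [mem_noneOpen, ← Ne, ← Set.nonempty_iff_ne_empty] at hω
        obtain ⟨a, haω, haI⟩ := hω
        have haZ : ({a} : Set ι) ∈ Z := ((mem_filter.1 (mem_coe.1 haI)).2).2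
        exact hZu (Set.singleton_subset_iff.2 haω) haZ
      rw [ind_of_not_mem (show ω ∉ Zᶜ from fun h => h this), mul_zero]
  -- conditional indicators `f(ω) = 1_{Xᶜ}(ω ∖ I)`, `g` likewise: antitone, bounded by 1
  set f : Set ι → ℝ := fun ω => ind Xᶜ (ω \ ↑I) with hf
  set g : Set ι → ℝ := fun ω => ind Zᶜ (ω \ ↑I) with hg
  have hfa : Antitone f := fun ω ω' hle =>
    ind_le_ind_of_imp fun (hω' : ω' \ ↑I ∈ Xᶜ) (hωX : ω \ ↑I ∈ X) => hω' (hXu (Set.sdiff_subset_sdiff_left hle) hωX)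
  have hga : Antitone g := fun ω ω' hle =>
    ind_le_ind_of_imp fun (hω' : ω' \ ↑I ∈ Zᶜ) (hωZ : ω \ ↑I ∈ Z) => hω' (hZu (Set.sdiff_subset_sdiff_left hle) hωZ)
  have hXc : pr p Xᶜ = dlt I p * ∑ ω, bernoulliWeight p ω * f ω := by
    rw [pr_eq_sum]
    conv_lhs => arg 2; ext ω; rw [hsuppX ω]
    exact sum_noneOpen_mul p I (ind Xᶜ)
  have hZc : pr p Zᶜ = dlt I p * ∑ ω, bernoulliWeight p ω * g ω := by
    rw [pr_eq_sum]
    conv_lhs => arg 2; ext ω; rw [hsuppZ ω]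
    exact sum_noneOpen_mul p I (ind Zᶜ)
  have hXZc : pr p (Xᶜ ∩ Zᶜ) = dlt I p * ∑ ω, bernoulliWeight p ω * (f ω * g ω) := by
    rw [pr_eq_sum]
    have : ∀ ω, ind (Xᶜ ∩ Zᶜ) ω = ind (noneOpen I) ω * (ind Xᶜ ω * ind Zᶜ ω) := by
      intro ω; rw [ind_inter, hsuppX ω]
      by_cases hω : ω ∈ noneOpen I
      · rw [ind_of_mem hω]; ring
      · rw [ind_of_not_mem hω]; ring
    conv_lhs => arg 2; ext ω; rw [this ω]
    exact sum_noneOpen_mul p I (fun ω => ind Xᶜ ω * ind Zᶜ ω)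
  -- Harris for the two antitone bounded functions
  have hH : (∑ ω, bernoulliWeight p ω * f ω) * (∑ ω, bernoulliWeight p ω * g ω) ≤
      ∑ ω, bernoulliWeight p ω * (f ω * g ω) :=
    harris_anti_anti (p_nonneg p) (p_le_one p) (sum_bernoulliWeight p) hfa hga
      (fun ω => ind_le_one _ _) (fun ω => ind_le_one _ _)
  have hdI0 : 0 ≤ dlt I p := dlt_nonneg I p
  have hdI1 : dlt I p ≤ 1 := dlt_le_one I p
  have hfg0 : 0 ≤ ∑ ω, bernoulliWeight p ω * (f ω * g ω) :=
    sum_nonneg fun ω _ => mul_nonneg (bw_nonneg p ω) (mul_nonneg (ind_nonneg _ _) (ind_nonneg _ _))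
  -- Cov(X,Z) = Cov(Xᶜ,Zᶜ) ≥ (1 − dlt I)·μ(Xᶜ ∩ Zᶜ) ≥ (1 − dlt I)·dlt A
  have hcov : pr p (X ∩ Z) - pr p X * pr p Z = pr p (Xᶜ ∩ Zᶜ) - pr p Xᶜ * pr p Zᶜ := by
    rw [pr_compl_inter_compl, pr_compl, pr_compl]; ring
  have hlow : dlt A p ≤ pr p (Xᶜ ∩ Zᶜ) := by
    rw [← pr_noneOpen]
    exact pr_mono p (Set.subset_inter (noneOpen_subset_compl hXd hX0) (noneOpen_subset_compl hZd hZ0))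
  have hIeq : ∏ a ∈ I, (1 - (p a : ℝ)) = dlt I p := rfl
  rw [hcov, hIeq, hXZc, hXc, hZc]
  rw [hXZc] at hlow
  have hdA0 : 0 ≤ dlt A p := dlt_nonneg A p
  nlinarith [mul_le_mul_of_nonneg_left hH (mul_nonneg hdI0 hdI0), mul_le_mul_of_nonneg_left hlow (sub_nonneg.2 hdI1),
    mul_nonneg hdI0 hfg0]

end SahiHittingSlot

end Summit.CriticalPhenomena.PercolationContinuityZ3.Theorems
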